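import Summits.NavierStokesRegularity.NavierStokesRegularity.Theorems.LerayQuarterDissipationFiniteDissipationLiouvilleErgodicHull
import Summits.NavierStokesRegularity.NavierStokesRegularity.Theorems.LerayQuarterDissipationRecurrentDissipativeLiouvilleCriticalRecurrent
import HarnessLib

/-!
# Crux `FiniteDissipationLiouville` (stmt-NavierStokesRegularity-22144), line `birth`:
# AVERAGED IDENTITIES ON THE WANDERING STRATUM and the quasi-regular critical element of the crux

Helper file (theorems only, `--supports` the crux), companion of `…ErgodicHull`. There the
invariant measures of the scaling flow on the compact hull (Kryloff–Bogoliouboff) and Birkhoff's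
theorem produce, inside every class `𝒟_{C,K}` containing a singular uniformly recurrent member, a
QUASI-REGULAR critical element `W`: every tame observable `G` (continuous along `𝒟_{C,K}` for
uniform convergence on the slab pieces) is bounded on the scaling orbit of `W` and has convergent
Cesàro means `N⁻¹ Σ_{k<N} G(W_{λ^k})`. This file records what that buys, in field-level clauses:

* `tendsto_cesaro_flux` — **zero mean flux**: for every tame `F` the means of the scaling flux
  `F(W_{λ^{k+1}}) − F(W_{λ^k})` tend to `0`. Hence every identity `source = flux of F` valid
  along scaling orbits of `𝒟_{C,K}` holds ON AVERAGE WITH ZERO FLUX along the quasi-regular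
  critical element — exactly as a period average over a discretely self-similar profile (where the
  orbit is periodic and the flux telescopes over a period). This is the transfer of
  "period-averaged identities from DSS to the wandering stratum" asked for by lead g11;
* `cesaro_nonneg`, `tendsto_cesaro_shift` — one-signed sources have nonnegative mean; the Cesàro
  mean is shift (= rescaling) invariant;
* `exists_quasiRegular_criticalElement` — THE PACKAGE FOR THE COMPOSITION: if some `𝒟_{C,K}` has a
  singular member then for every step `λ > 0` there are `K_c ∈ (K₀, K]` and a critical element
  `W ∈ 𝒟_{C,K_c}` — singular, uniformly recurrent, critical (no singular member below `K_c`),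
  near-saturating — which is quasi-regular for `λ` (the skeleton's v24 clause);
* `finiteDissipationLiouville_iff_no_quasiRegular` — bookkeeping: the crux is equivalent to its
  restriction to quasi-regular critical elements ("no statistically self-similar
  finite-dissipation Type-I singularity with convergent scaling statistics").

Honest framing: PORTRAIT / TOOL. The known identities along Leray's similarity flow (period
enstrophy identity, `|y|⁻¹`-weighted and Gaussian-weighted local energy identities) all have
UNSIGNED sources on the envelope class, so nothing is excluded; verdict FRONTIER unchanged
(blocked on `∀ c>1, TypeIDSSLiouville c`, NECESSARY by `…Hardness`). No summit is proved by this
file; Navier–Stokes regularity is NOT proved by anything here.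

References: N. Kryloff, N. Bogoliouboff, Ann. of Math. 38 (1937) [KryloffBogoliouboff1937];
P. Walters, GTM 79 (1982), §6.2, §1.6 [Walters1982]; Z. Bradshaw, T.-P. Tsai, Comm. PDE 42 (2017)
§5 OP 5.1 [BradshawTsai2017CPDE].
-/

noncomputable section

-- the summit and its single problem share the name (D-0017 nested layout)
set_option linter.dupNamespace false

namespace Summit.NavierStokesRegularity.NavierStokesRegularity.Theorems.FiniteDissipationLiouville.ErgodicHull

open scoped Topology
open MeasureTheory Set Function Filter Metric TopologicalSpace Topology
open Literature.Analysis.FluidPDE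

/-! ### §1 Cesàro calculus: telescoping fluxes, signs, shifts -/

/-- Cesàro means of a telescoping sequence with bounded terms tend to zero:
`N⁻¹ Σ_{k<N} (a(k+1) − a k) = (a N − a 0)/N → 0` when `|a k| ≤ B`. [folklore] -/
theorem tendsto_cesaro_sub_of_bounded {a : ℕ → ℝ} {B : ℝ} (hB : ∀ k, |a k| ≤ B) :
    Tendsto (fun N : ℕ => (N : ℝ)⁻¹ * ∑ k ∈ Finset.range N, (a (k + 1) - a k)) atTop (𝓝 0) := by
  have htel : ∀ N : ℕ, ∑ k ∈ Finset.range N, (a (k + 1) - a k) = a N - a 0 := fun N =>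
    Finset.sum_range_sub a N
  simp_rw [htel]
  have hb : ∀ N : ℕ, |(N : ℝ)⁻¹ * (a N - a 0)| ≤ 2 * B * (N : ℝ)⁻¹ := by
    intro N
    rw [abs_mul, abs_inv, Nat.abs_cast, mul_comm]
    refine mul_le_mul_of_nonneg_right ?_ (inv_nonneg.2 N.cast_nonneg)
    calc |a N - a 0| ≤ |a N| + |a 0| := abs_sub _ _
      _ ≤ B + B := add_le_add (hB N) (hB 0)
      _ = 2 * B := by ring
  have hlim : Tendsto (fun N : ℕ => 2 * B * (N : ℝ)⁻¹) atTop (𝓝 0) := by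
    simpa using tendsto_inv_atTop_nhds_zero_nat.const_mul (2 * B)
  exact squeeze_zero_norm (fun N => by rw [Real.norm_eq_abs]; exact hb N) hlim

/-- **One-signed sources have nonnegative mean**: if `a k ≥ 0` and the Cesàro means of `a`
converge to `ℓ`, then `0 ≤ ℓ`. [folklore] -/
theorem cesaro_nonneg {a : ℕ → ℝ} {ℓ : ℝ}
    (h : Tendsto (fun N : ℕ => (N : ℝ)⁻¹ * ∑ k ∈ Finset.range N, a k) atTop (𝓝 ℓ))
    (ha : ∀ k, 0 ≤ a k) : 0 ≤ ℓ :=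
  ge_of_tendsto' h fun N =>
    mul_nonneg (inv_nonneg.2 N.cast_nonneg) (Finset.sum_nonneg fun k _ => ha k)

/-- **Shift invariance of the Cesàro mean**: for a bounded sequence, the means of `k ↦ a (k+1)`
converge to the same limit as the means of `a`. [folklore] -/
theorem tendsto_cesaro_shift {a : ℕ → ℝ} {B ℓ : ℝ} (hB : ∀ k, |a k| ≤ B)
    (h : Tendsto (fun N : ℕ => (N : ℝ)⁻¹ * ∑ k ∈ Finset.range N, a k) atTop (𝓝 ℓ)) :
    Tendsto (fun N : ℕ => (N : ℝ)⁻¹ * ∑ k ∈ Finset.range N, a (k + 1)) atTop (𝓝 ℓ) := by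
  have h1 := h.add (tendsto_cesaro_sub_of_bounded hB)
  rw [add_zero] at h1
  refine h1.congr fun N => ?_
  rw [← mul_add, ← Finset.sum_add_distrib]
  congr 1
  exact Finset.sum_congr rfl fun k _ => by ring

/-! ### §2 Averaged identities along a quasi-regular element -/

/-- **ZERO MEAN FLUX (averaged identities on the wandering stratum).** Let `W` be a field and `F`
an observable bounded on the scaling orbit `{W_c : c > 0}` (clause (a) of
`exists_quasiRegular`), `λ > 0`. Then the Cesàro means of the scaling flux
`F(W_{λ^{k+1}}) − F(W_{λ^k})` tend to `0`. So if an identity `S(v) = F(v_λ) − F(v)` holds for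
every member `v` of the class (a "source = flux" balance over one scaling step), the source `S`
has ZERO MEAN along `W` — as it has over a period of a discretely self-similar profile.
[cite: Walters1982, §1.6 (Birkhoff averages; invariance of the limit)] -/
theorem tendsto_cesaro_flux {lam : ℝ} (hlam : 0 < lam)
    {W : ℝ → EuclideanSpace ℝ (Fin 3) → EuclideanSpace ℝ (Fin 3)}
    {F : (ℝ → EuclideanSpace ℝ (Fin 3) → EuclideanSpace ℝ (Fin 3)) → ℝ} {B : ℝ}
    (hB : ∀ c : ℝ, 0 < c → |F (nsRescale c W)| ≤ B) :
    Tendsto (fun N : ℕ => (N : ℝ)⁻¹ * ∑ k ∈ Finset.range N,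
      (F (nsRescale (lam ^ (k + 1)) W) - F (nsRescale (lam ^ k) W))) atTop (𝓝 0) :=
  tendsto_cesaro_sub_of_bounded (a := fun k => F (nsRescale (lam ^ k) W)) fun k =>
    hB _ (pow_pos hlam k)

/-- **Source = flux ⇒ the source has zero mean.** If `S v = F (v_λ) − F v` for every rescaling
`v = W_c` of `W` (`c > 0`) and `F` is bounded on the scaling orbit of `W`, then the Cesàro means
of `S(W_{λ^k})` tend to `0`; in particular (with `cesaro_nonneg`) a source of ONE SIGN along the
orbit has mean zero. [folklore] -/
theorem tendsto_cesaro_source {lam : ℝ} (hlam : 0 < lam)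
    {W : ℝ → EuclideanSpace ℝ (Fin 3) → EuclideanSpace ℝ (Fin 3)}
    {F S : (ℝ → EuclideanSpace ℝ (Fin 3) → EuclideanSpace ℝ (Fin 3)) → ℝ} {B : ℝ}
    (hB : ∀ c : ℝ, 0 < c → |F (nsRescale c W)| ≤ B)
    (hSF : ∀ c : ℝ, 0 < c → S (nsRescale c W) = F (nsRescale lam (nsRescale c W)) - F (nsRescale c W)) :
    Tendsto (fun N : ℕ => (N : ℝ)⁻¹ * ∑ k ∈ Finset.range N, S (nsRescale (lam ^ k) W))
      atTop (𝓝 0) := by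
  refine (tendsto_cesaro_flux hlam hB).congr fun N => ?_
  congr 1
  refine Finset.sum_congr rfl fun k _ => ?_
  rw [hSF _ (pow_pos hlam k), ← nsRescale_mul, pow_succ]

/-! ### §3 The quasi-regular critical element of the crux -/

/-- **THE QUASI-REGULAR CRITICAL ELEMENT (package for the skeleton's composition).** There is an
absolute `K₀ > 0` such that: if some `𝒟_{C,K}` has a member singular at the apex, then for every
scaling step `λ > 0` there are `K_c ∈ (K₀, K]` and `W ∈ 𝒟_{C,K_c}` which is SINGULAR at the apex,
UNIFORMLY RECURRENT, CRITICAL (no member of `𝒟_{C,K'}`, `K' < K_c`, is singular),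
NEAR-SATURATING, and QUASI-REGULAR for `λ`: every observable continuous along `𝒟_{C,K_c}` for
uniform convergence on the slab pieces is bounded on the scaling orbit of `W` and has convergent
Cesàro means `N⁻¹ Σ_{k<N} G(W_{λ^k})` (`CriticalElement.exists_recurrent_criticalElement` +
`exists_quasiRegular` + `dissipation_nearMax_of_minimal`).
[cite: KryloffBogoliouboff1937, §1] [cite: Walters1982, §6.2 Corollary 6.9.1; §1.6] -/
theorem exists_quasiRegular_criticalElement :
    ∃ K₀ : ℝ, 0 < K₀ ∧ ∀ (C K : ℝ)
      (u : ℝ → EuclideanSpace ℝ (Fin 3) → EuclideanSpace ℝ (Fin 3)), IsTypeIAncientMild C u →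
      (∀ s : ℝ, s < 0 → ∫⁻ x, ‖fderiv ℝ (u s) x‖ₑ ^ 2 ≤ ENNReal.ofReal (K / Real.sqrt (-s))) →
      (∀ r > 0, ∀ M : ℝ, ∃ t ∈ Set.Ioo (-(r ^ 2)) (0 : ℝ),
        ∃ x ∈ Metric.ball (0 : EuclideanSpace ℝ (Fin 3)) r, M < ‖u t x‖) →
      ∀ lam : ℝ, 0 < lam →
      ∃ (Kc : ℝ) (W : ℝ → EuclideanSpace ℝ (Fin 3) → EuclideanSpace ℝ (Fin 3)),
        K₀ < Kc ∧ Kc ≤ K ∧ IsTypeIAncientMild C W ∧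
        (∀ s : ℝ, s < 0 → ∫⁻ x, ‖fderiv ℝ (W s) x‖ₑ ^ 2 ≤ ENNReal.ofReal (Kc / Real.sqrt (-s))) ∧
        (∀ r > 0, ∀ M : ℝ, ∃ t ∈ Set.Ioo (-(r ^ 2)) (0 : ℝ),
          ∃ x ∈ Metric.ball (0 : EuclideanSpace ℝ (Fin 3)) r, M < ‖W t x‖) ∧
        (∀ ε > 0, ∀ R > 1, ∃ L > 0, ∀ a : ℝ, ∃ σ ∈ Set.Icc a (a + L),
          ∀ s ∈ Set.Icc (-(R ^ 2)) (-(R⁻¹) ^ 2),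
          ∀ y ∈ Metric.closedBall (0 : EuclideanSpace ℝ (Fin 3)) R,
            ‖Real.exp σ • W (Real.exp (2 * σ) * s) (Real.exp σ • y) - W s y‖ ≤ ε) ∧
        (∀ K' : ℝ, K' < Kc → ∀ v : ℝ → EuclideanSpace ℝ (Fin 3) → EuclideanSpace ℝ (Fin 3),
          IsTypeIAncientMild C v →
          (∀ s : ℝ, s < 0 → ∫⁻ x, ‖fderiv ℝ (v s) x‖ₑ ^ 2 ≤ ENNReal.ofReal (K' / Real.sqrt (-s))) →
          ¬ (∀ r > 0, ∀ M : ℝ, ∃ t ∈ Set.Ioo (-(r ^ 2)) (0 : ℝ),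
            ∃ x ∈ Metric.ball (0 : EuclideanSpace ℝ (Fin 3)) r, M < ‖v t x‖)) ∧
        (∀ ε : ℝ, 0 < ε → ∃ Λ : ℝ, 1 < Λ ∧ ∀ τ : ℝ, τ < 0 →
          ∃ t ∈ Set.Icc (Λ ^ 2 * τ) (τ / Λ ^ 2),
            ENNReal.ofReal ((Kc - ε) / Real.sqrt (-t)) < ∫⁻ x, ‖fderiv ℝ (W t) x‖ₑ ^ 2) ∧
        ∀ G : (ℝ → EuclideanSpace ℝ (Fin 3) → EuclideanSpace ℝ (Fin 3)) → ℝ,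
          (∀ (v : ℕ → ℝ → EuclideanSpace ℝ (Fin 3) → EuclideanSpace ℝ (Fin 3))
              (w : ℝ → EuclideanSpace ℝ (Fin 3) → EuclideanSpace ℝ (Fin 3)),
            (∀ j, IsTypeIAncientMild C (v j)) →
            (∀ j, ∀ s : ℝ, s < 0 →
              ∫⁻ x, ‖fderiv ℝ (v j s) x‖ₑ ^ 2 ≤ ENNReal.ofReal (Kc / Real.sqrt (-s))) →
            IsTypeIAncientMild C w →
            (∀ s : ℝ, s < 0 → ∫⁻ x, ‖fderiv ℝ (w s) x‖ₑ ^ 2 ≤ ENNReal.ofReal (Kc / Real.sqrt (-s))) →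
            (∀ n : ℕ, TendstoUniformlyOn (fun j z => v j z.1 z.2) (fun z => w z.1 z.2) atTop
              (Set.Icc (-((n : ℝ) + 2)) (-(1 / ((n : ℝ) + 2))) ×ˢ
                Metric.closedBall (0 : EuclideanSpace ℝ (Fin 3)) ((n : ℝ) + 2))) →
            Tendsto (fun j => G (v j)) atTop (𝓝 (G w))) →
          (∃ B : ℝ, ∀ c : ℝ, 0 < c → |G (nsRescale c W)| ≤ B) ∧
          ∃ ℓ : ℝ, Tendsto (fun N : ℕ => (N : ℝ)⁻¹ * ∑ k ∈ Finset.range N,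
            G (nsRescale (lam ^ k) W)) atTop (𝓝 ℓ) := by
  obtain ⟨K₀, hK₀, hce⟩ := CriticalElement.exists_recurrent_criticalElement
  refine ⟨K₀, hK₀, fun C K u hu hlaw hsing lam hlam => ?_⟩
  obtain ⟨Kc, w, hK₀c, hKcK, hw, hDw, hsw, hrec, hmin, -⟩ := hce C K u hu hlaw hsing
  obtain ⟨W, hW, hDW, hsW, hrecW, -, hq⟩ := exists_quasiRegular hlam hw hDw hsw hrec
  exact ⟨Kc, W, hK₀c, hKcK, hW, hDW, hsW, hrecW, hmin,
    CriticalElement.dissipation_nearMax_of_minimal hmin hW hDW hsW, hq⟩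

/-- **Bookkeeping: the crux is its restriction to quasi-regular critical elements.**
`FiniteDissipationLiouville` holds iff for all `C, K_c` and every step `λ > 0`, every member of
`𝒟_{C,K_c}` that is uniformly recurrent, critical and quasi-regular for `λ` (tame observables
bounded on its scaling orbit with convergent Cesàro means along `W_{λ^k}`) is regular at the apex
— "no statistically self-similar finite-dissipation Type-I singularity with convergent scaling
statistics". (⇒: the crux forbids singular members; ⇐: `exists_quasiRegular_criticalElement`.)
[cite: BradshawTsai2017CPDE, §5 Open Problem 5.1 (the DSS sub-case)] -/
theorem finiteDissipationLiouville_iff_no_quasiRegular :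
    Theses.LerayQuarterDissipation.FiniteDissipationLiouville ↔
    ∀ (C Kc lam : ℝ), 0 < lam → ∀ (W : ℝ → EuclideanSpace ℝ (Fin 3) → EuclideanSpace ℝ (Fin 3)),
      IsTypeIAncientMild C W →
      (∀ s : ℝ, s < 0 → ∫⁻ x, ‖fderiv ℝ (W s) x‖ₑ ^ 2 ≤ ENNReal.ofReal (Kc / Real.sqrt (-s))) →
      (∀ ε > 0, ∀ R > 1, ∃ L > 0, ∀ a : ℝ, ∃ σ ∈ Set.Icc a (a + L),
        ∀ s ∈ Set.Icc (-(R ^ 2)) (-(R⁻¹) ^ 2),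
        ∀ y ∈ Metric.closedBall (0 : EuclideanSpace ℝ (Fin 3)) R,
          ‖Real.exp σ • W (Real.exp (2 * σ) * s) (Real.exp σ • y) - W s y‖ ≤ ε) →
      (∀ K' : ℝ, K' < Kc → ∀ v : ℝ → EuclideanSpace ℝ (Fin 3) → EuclideanSpace ℝ (Fin 3),
        IsTypeIAncientMild C v →
        (∀ s : ℝ, s < 0 → ∫⁻ x, ‖fderiv ℝ (v s) x‖ₑ ^ 2 ≤ ENNReal.ofReal (K' / Real.sqrt (-s))) →
        ¬ (∀ r > 0, ∀ M : ℝ, ∃ t ∈ Set.Ioo (-(r ^ 2)) (0 : ℝ),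
          ∃ x ∈ Metric.ball (0 : EuclideanSpace ℝ (Fin 3)) r, M < ‖v t x‖)) →
      (∀ G : (ℝ → EuclideanSpace ℝ (Fin 3) → EuclideanSpace ℝ (Fin 3)) → ℝ,
        (∀ (v : ℕ → ℝ → EuclideanSpace ℝ (Fin 3) → EuclideanSpace ℝ (Fin 3))
            (w : ℝ → EuclideanSpace ℝ (Fin 3) → EuclideanSpace ℝ (Fin 3)),
          (∀ j, IsTypeIAncientMild C (v j)) →
          (∀ j, ∀ s : ℝ, s < 0 →
            ∫⁻ x, ‖fderiv ℝ (v j s) x‖ₑ ^ 2 ≤ ENNReal.ofReal (Kc / Real.sqrt (-s))) →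
          IsTypeIAncientMild C w →
          (∀ s : ℝ, s < 0 → ∫⁻ x, ‖fderiv ℝ (w s) x‖ₑ ^ 2 ≤ ENNReal.ofReal (Kc / Real.sqrt (-s))) →
          (∀ n : ℕ, TendstoUniformlyOn (fun j z => v j z.1 z.2) (fun z => w z.1 z.2) atTop
            (Set.Icc (-((n : ℝ) + 2)) (-(1 / ((n : ℝ) + 2))) ×ˢ
              Metric.closedBall (0 : EuclideanSpace ℝ (Fin 3)) ((n : ℝ) + 2))) →
          Tendsto (fun j => G (v j)) atTop (𝓝 (G w))) →
        (∃ B : ℝ, ∀ c : ℝ, 0 < c → |G (nsRescale c W)| ≤ B) ∧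
        ∃ ℓ : ℝ, Tendsto (fun N : ℕ => (N : ℝ)⁻¹ * ∑ k ∈ Finset.range N,
          G (nsRescale (lam ^ k) W)) atTop (𝓝 ℓ)) →
      ¬ (∀ r > 0, ∀ M : ℝ, ∃ t ∈ Set.Ioo (-(r ^ 2)) (0 : ℝ),
          ∃ x ∈ Metric.ball (0 : EuclideanSpace ℝ (Fin 3)) r, M < ‖W t x‖) := by
  refine ⟨fun hfdl C Kc lam _ W hW hDW _ _ _ => hfdl C Kc W hW hDW, fun h C K u hu hD hsing => ?_⟩
  obtain ⟨K₀, -, hce⟩ := exists_quasiRegular_criticalElement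
  obtain ⟨Kc, W, -, -, hW, hDW, hsW, hrecW, hmin, -, hq⟩ := hce C K u hu hD hsing 2 two_pos
  exact h C Kc 2 two_pos W hW hDW hrecW hmin hq hsW

end Summit.NavierStokesRegularity.NavierStokesRegularity.Theorems.FiniteDissipationLiouville.ErgodicHull

end
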